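import Summits.AtomisticToContinuum.HydrodynamicLimit.Theorems.EquilibriumClampedCollisionalWindowLD.Negative.Concrete

/-!
# The final inequality, part 1 (helper file of the refutation of `EquilibriumClampedCollisionalWindowLD`, stmt-AtomisticToContinuum-13733; see `Cruxes/EquilibriumClampedCollisionalWindowLD/Disproof.lean` and the evidence WITNESS.md; no Theses declaration is asserted positively; refuter-cdisprove-stmt-AtomisticToContinuum-13733-0)
-/

noncomputable section

open Real
open scoped InnerProductSpace

namespace Summit.AtomisticToContinuum.HydrodynamicLimit.Theorems

namespace EquilibriumClampedCollisionalWindowLDNegative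

/-! ## Stage E: the final inequality -/

section FinalIneq

open MeasureTheory Literature.Analysis.FluidPDE Literature.Analysis.FunctionSpaces Literature.MathematicalPhysics.KineticTheory

namespace Lat

variable (Λ : Lat)

/-- The Gaussian prefactor `A = (4π/3) u³ (2π)^{-3/2}`. -/
def gA (u : ℝ) : ℝ := (Real.pi * 4 / 3 * u ^ 3) * (2 * Real.pi) ^ (-(3 : ℝ) / 2)

/-- The quadratic cost of the velocity pinning. -/
def Scost (Λ : Lat) : ℝ := ∑ ς : Λ.Slot, (‖Λ.drv ς‖ + Λ.P.u) ^ 2 / 2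

/-- **The event bound factorises**: `evB = (4π r³/3)^{N+1} · A^{#slots} · e^{-S}`. [folklore] -/
theorem evB_eq (N : ℕ) : Λ.evB N = (Real.pi * 4 / 3 * Λ.P.r ^ 3) ^ (N + 1) *
    (gA Λ.P.u ^ Fintype.card Λ.Slot * Real.exp (-Λ.Scost)) := by
  unfold evB Scost
  congr 1
  have h : ∀ ς : Λ.Slot, gaussBallB (Λ.drv ς) Λ.P.u = gA Λ.P.u * Real.exp (-((‖Λ.drv ς‖ + Λ.P.u) ^ 2 / 2)) := by
    intro ς; unfold gaussBallB gA; ring_nf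
  rw [Finset.prod_congr rfl (fun ς _ => h ς), Finset.prod_mul_distrib, Finset.prod_const, Finset.card_univ,
    ← Real.exp_sum, ← Finset.sum_neg_distrib]

/-- Norm of the nominal velocity: `V` for drivers, `0` otherwise. [folklore] -/
theorem norm_drv (hV : 0 ≤ Λ.P.V) (ς : Λ.Slot) [Decidable (Λ.IsDriver ς)] :
    ‖Λ.drv ς‖ = if Λ.IsDriver ς then Λ.P.V else 0 := by
  unfold drv
  split_ifs with h
  · rw [norm_smul, norm_bv, mul_one, Real.norm_of_nonneg hV]
  · simp

/-- **The pinning cost**: `S ≤ #drivers (V+u)²/2 + #slots u²/2`. [folklore] -/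
theorem Scost_le (hV : 0 ≤ Λ.P.V) [DecidablePred Λ.IsDriver] :
    Λ.Scost ≤ ((Finset.univ : Finset Λ.Slot).filter Λ.IsDriver).card * ((Λ.P.V + Λ.P.u) ^ 2 / 2) +
      Fintype.card Λ.Slot * (Λ.P.u ^ 2 / 2) := by
  classical
  unfold Scost
  have hpt : ∀ ς : Λ.Slot, (‖Λ.drv ς‖ + Λ.P.u) ^ 2 / 2 ≤
      (if Λ.IsDriver ς then (Λ.P.V + Λ.P.u) ^ 2 / 2 else 0) + Λ.P.u ^ 2 / 2 := by
    intro ς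
    rw [Λ.norm_drv hV ς]
    split_ifs with h
    · have : 0 ≤ Λ.P.u ^ 2 / 2 := by positivity
      linarith
    · simp
  calc ∑ ς : Λ.Slot, (‖Λ.drv ς‖ + Λ.P.u) ^ 2 / 2
      ≤ ∑ ς : Λ.Slot, ((if Λ.IsDriver ς then (Λ.P.V + Λ.P.u) ^ 2 / 2 else 0) + Λ.P.u ^ 2 / 2) :=
        Finset.sum_le_sum fun ς _ => hpt ς
    _ = _ := by
        rw [Finset.sum_add_distrib, ← Finset.sum_filter, Finset.sum_const, Finset.sum_const, Finset.card_univ,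
          nsmul_eq_mul, nsmul_eq_mul]

/-- `n^n e^{-n} ≤ n!`. [folklore] -/
theorem pow_mul_exp_neg_le_factorial (n : ℕ) : (n : ℝ) ^ n * Real.exp (-n) ≤ (n.factorial : ℝ) := by
  have h := Real.pow_div_factorial_le_exp (n : ℝ) (Nat.cast_nonneg n) n
  have hf : (0 : ℝ) < n.factorial := by exact_mod_cast Nat.factorial_pos n
  rw [div_le_iff₀ hf] at h
  rw [Real.exp_neg]
  have he := Real.exp_pos (n : ℝ)
  calc (n : ℝ) ^ n * (Real.exp n)⁻¹ ≤ Real.exp n * n.factorial * (Real.exp n)⁻¹ :=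
        mul_le_mul_of_nonneg_right h (by positivity)
    _ = n.factorial := by field_simp

/-- A product lower bound for the gain constant. [folklore] -/
theorem gainT_ge_of (P : Params) {a b : ℝ} (hX : 1 ≤ 2 - 4 * (2 * Real.pi * (P.errA + P.fwd) + Real.pi * P.ε))
    (hA : a ≤ P.ε * (1 - P.αn ^ 2 / 2)) (hB : b ≤ P.clo * (P.clo - 2 * P.u)) (ha : 0 ≤ a) (hb : 0 ≤ b) :
    a * b / 2 ≤ gainT P := by
  unfold gainT
  have hA0 : 0 ≤ P.ε * (1 - P.αn ^ 2 / 2) := ha.trans hA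
  have hB0 : 0 ≤ P.clo * (P.clo - 2 * P.u) := hb.trans hB
  have h1 : a * b ≤ P.ε * (1 - P.αn ^ 2 / 2) * (P.clo * (P.clo - 2 * P.u)) := mul_le_mul hA hB hb hA0
  have h2 : P.ε * (1 - P.αn ^ 2 / 2) * (P.clo * (P.clo - 2 * P.u)) ≤
      (2 - 4 * (2 * Real.pi * (P.errA + P.fwd) + Real.pi * P.ε)) * (P.ε * (1 - P.αn ^ 2 / 2)) * (P.clo * (P.clo - 2 * P.u)) := by
    rw [mul_assoc (2 - 4 * _)]
    exact le_mul_of_one_le_left (mul_nonneg hA0 hB0) hX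
  linarith

end Lat

namespace LatW

variable {l n t : ℕ} (hl : 2 ≤ l) (ht : 24 * l ^ 2 ≤ t) (hn : 2 ≤ n)
include hl ht hn

omit ht in
/-- `c ≤ 1/16` once `n ≥ 2`. -/
theorem c_le' : cscale l n ≤ 1 / 16 := by
  unfold cscale
  have hl2 : (2:ℝ) ≤ l := by exact_mod_cast hl
  have hn1 : (2:ℝ) ≤ n := by exact_mod_cast hn
  have hl8 : (2:ℝ) ^ 3 ≤ (l : ℝ) ^ 3 := pow_le_pow_left₀ (by norm_num) hl2 3
  have : (16:ℝ) ≤ (l : ℝ) ^ 3 * n := by nlinarith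
  exact one_div_le_one_div_of_le (by norm_num) this

/-- **The gain constant of the witness**: `gainT ≥ (9/50) c t⁶`. [folklore] -/
theorem gainT_ge : (9 / 50) * cscale l n * (t : ℝ) ^ 6 ≤ Lat.gainT (LatW l n t).P := by
  have hn1 : 1 ≤ n := by omega
  have hc := c_pos hl hn1
  have hc' := hc.ne'
  have hc16 := c_le' hl hn
  have h1 := bpar.T1 hl ht; have hT := bpar.Tpos hl ht
  obtain ⟨-, -, -, -, -, -, -, -, w9, w10⟩ := bpar.win_facts hl ht
  obtain ⟨hclo1, hclo2⟩ := bpar.clo_bd hl ht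
  obtain ⟨hu0, hu⟩ := bpar.u_bd hl ht
  obtain ⟨hαn0, hαn⟩ := bpar.αn_bd hl ht
  have hαn1 : (bpar l t).αn ≤ 1 := (bpar.sep_facts hl ht).2.1
  have hX : 1 ≤ 2 - 4 * (2 * Real.pi * ((LatW l n t).P.errA + (LatW l n t).P.fwd) + Real.pi * (LatW l n t).P.ε) := by
    rw [P_eq, Params.scale_errA _ hc', Params.scale_fwd _ hc', Params.scale_ε, Params.errA, Params.fwd]
    have e : 2 * Real.pi * (cscale l n * ((bpar l t).r + (bpar l t).Tmax * (bpar l t).u +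
        (bpar l t).Tmax * (bpar l t).ρs) + cscale l n * ((bpar l t).θhi * (bpar l t).Vhi +
        ((bpar l t).r + (bpar l t).Tmax * (bpar l t).u) + (bpar l t).Tmax * (bpar l t).ρs)) +
        Real.pi * (cscale l n * (bpar l t).ε) =
        cscale l n * (2 * Real.pi * (((bpar l t).r + (bpar l t).Tmax * (bpar l t).u + (bpar l t).Tmax * (bpar l t).ρs) +
          ((bpar l t).θhi * (bpar l t).Vhi + ((bpar l t).r + (bpar l t).Tmax * (bpar l t).u) +
          (bpar l t).Tmax * (bpar l t).ρs)) + Real.pi * (bpar l t).ε) := by ring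
    rw [e]
    have := mul_le_mul_of_nonneg_left w9 hc.le
    nlinarith
  have hA : cscale l n * (4 / 5) * (1 / 2) ≤ (LatW l n t).P.ε * (1 - (LatW l n t).P.αn ^ 2 / 2) := by
    rw [P_eq, Params.scale_ε, Params.scale_αn _ hc', bpar.ε_eq]
    refine mul_le_mul_of_nonneg_left ?_ (by positivity)
    have := pow_le_one₀ hαn0 hαn1 (n := 2); linarith
  have hu1 : (bpar l t).u ≤ 1 / 2 := by have := bpar.small hl ht (by norm_num : 1 ≤ 40); linarith
  have ht3 := bpar.T3 hl ht
  have hB : (9 / 10) * (t : ℝ) ^ 6 ≤ (LatW l n t).P.clo * ((LatW l n t).P.clo - 2 * (LatW l n t).P.u) := by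
    rw [P_eq, Params.scale_clo _ hc', Params.scale_u]
    have h3 : (t : ℝ) ^ 3 - 3 ≤ (bpar l t).clo - 2 * (bpar l t).u := by linarith
    have h0 : 0 ≤ (t : ℝ) ^ 3 - 3 := by linarith
    have := mul_le_mul (by linarith : (t : ℝ) ^ 3 - 3 ≤ (bpar l t).clo) h3 h0 (by linarith)
    nlinarith
  have := Lat.gainT_ge_of (LatW l n t).P hX hA hB (by positivity) (by positivity)
  linarith

omit ht in
/-- `Q n² ≤ 𝒩 / m` for the witness (`𝒩 = (l n)³`). [folklore] -/
theorem Qn2_le : (((LatW l n t).Q * ((LatW l n t).n * (LatW l n t).n) : ℕ) : ℝ) ≤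
    ((l : ℝ) * n) ^ 3 / (LatW l n t).m := by
  have hm : (0:ℝ) < (LatW l n t).m := by rw [m_eq]; positivity
  have hQ := Nat.cast_div_le (α := ℝ) (m := (LatW l n t).M) (n := (LatW l n t).m)
  have hQ' : ((LatW l n t).Q : ℝ) ≤ ((LatW l n t).M : ℝ) / (LatW l n t).m := hQ
  rw [M_eq] at hQ'
  push_cast at hQ' ⊢
  rw [n_eq]
  have hn0 : (0:ℝ) ≤ (n : ℝ) * n := by positivity
  calc ((LatW l n t).Q : ℝ) * ((n : ℝ) * n) ≤ (l : ℝ) ^ 3 * n / (LatW l n t).m * ((n : ℝ) * n) :=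
        mul_le_mul_of_nonneg_right hQ' hn0
    _ = ((l : ℝ) * n) ^ 3 / (LatW l n t).m := by ring

omit hn in
/-- `m ≤ 7 t⁷ l²` and `6 t⁷ l² ≤ m`. -/
theorem m_bd : 6 * (t : ℝ) ^ 7 * (l : ℝ) ^ 2 ≤ ((LatW l n t).m : ℝ) ∧ ((LatW l n t).m : ℝ) ≤ 7 * (t : ℝ) ^ 7 * (l : ℝ) ^ 2 := by
  rw [m_eq]; push_cast
  have h1 := bpar.T1 hl ht
  have hl2 : (2:ℝ) ≤ l := by exact_mod_cast hl
  have : (3:ℝ) ≤ (t : ℝ) ^ 7 * (l : ℝ) ^ 2 := by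
    have := one_le_pow₀ (n := 7) h1; nlinarith
  constructor <;> nlinarith

/-- **The exponent of the witness from below**:
`Fmin ≥ β 𝒩 ((9/350) t²/l² - 40 |Z-1| / t⁴)`. [folklore] -/
theorem Fmin_ge {N : ℕ} (hN : N + 1 = (l * n) ^ 3) {β : ℝ} (hβ : 0 ≤ β) (Z : ℝ) :
    β * (((l : ℝ) * n) ^ 3) * ((9 / 350) * (t : ℝ) ^ 2 / (l : ℝ) ^ 2 - 40 * |Z - 1| / (t : ℝ) ^ 4) ≤
      (LatW l n t).Fmin N (4 * t ^ 7 * l ^ 2) β Z := by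
  have hn1 : 1 ≤ n := by omega
  have hc := c_pos hl hn1
  have hc' := hc.ne'
  have h1 := bpar.T1 hl ht; have hT := bpar.Tpos hl ht
  have hl0 : (0:ℝ) < l := by exact_mod_cast (show 0 < l by omega)
  have hn0 : (0:ℝ) < n := by exact_mod_cast (show 0 < n by omega)
  obtain ⟨hm1, hm2⟩ := m_bd hl ht
  have hm0 : (0:ℝ) < (LatW l n t).m := lt_of_lt_of_le (by positivity) hm1
  have hg := gainT_ge hl ht hn
  set 𝒩 : ℝ := ((l : ℝ) * n) ^ 3 with h𝒩
  have h𝒩0 : 0 < 𝒩 := by positivity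
  -- term 1
  have hT1 : (9 / 350) * 𝒩 * (t : ℝ) ^ 2 / (l : ℝ) ^ 2 ≤
      (LatW l n t).w⁻¹ * ((LatW l n t).Tlow (4 * t ^ 7 * l ^ 2) * Lat.gainT (LatW l n t).P) := by
    have hTlow : (LatW l n t).Tlow (4 * t ^ 7 * l ^ 2) = 𝒩 * (t : ℝ) ^ 7 * (l : ℝ) ^ 2 / (LatW l n t).m := by
      unfold Lat.Tlow; rw [M_eq, n_eq]; push_cast; rw [h𝒩]; field_simp
    have hw : (LatW l n t).w⁻¹ = 1 / (cscale l n * ((t : ℝ) ^ 4 * (l : ℝ) ^ 2)) := by rw [w_eq]; exact inv_eq_one_div _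
    rw [hTlow, hw]
    have hTl0 : 0 ≤ 𝒩 * (t : ℝ) ^ 7 * (l : ℝ) ^ 2 / (LatW l n t).m := by positivity
    calc (9 / 350) * 𝒩 * (t : ℝ) ^ 2 / (l : ℝ) ^ 2
        ≤ 1 / (cscale l n * ((t : ℝ) ^ 4 * (l : ℝ) ^ 2)) * (𝒩 * (t : ℝ) ^ 7 * (l : ℝ) ^ 2 / (LatW l n t).m *
            ((9 / 50) * cscale l n * (t : ℝ) ^ 6)) := by
          rw [show 1 / (cscale l n * ((t : ℝ) ^ 4 * (l : ℝ) ^ 2)) * (𝒩 * (t : ℝ) ^ 7 * (l : ℝ) ^ 2 / (LatW l n t).m *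
            ((9 / 50) * cscale l n * (t : ℝ) ^ 6)) = (9 / 50) * 𝒩 * (t : ℝ) ^ 9 / (LatW l n t).m by
              field_simp]
          rw [div_le_div_iff₀ (by positivity) hm0]
          have h0 : 0 ≤ 9 / 350 * 𝒩 * (t : ℝ) ^ 2 := by positivity
          calc 9 / 350 * 𝒩 * (t : ℝ) ^ 2 * ((LatW l n t).m : ℝ) ≤ 9 / 350 * 𝒩 * (t : ℝ) ^ 2 * (7 * (t : ℝ) ^ 7 * (l : ℝ) ^ 2) :=
                mul_le_mul_of_nonneg_left hm2 h0
            _ = 9 / 50 * 𝒩 * (t : ℝ) ^ 9 * (l : ℝ) ^ 2 := by ring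
      _ ≤ _ := mul_le_mul_of_nonneg_left (mul_le_mul_of_nonneg_left hg hTl0) (by positivity)
  -- term 2
  obtain ⟨-, -, hVhi1, hVhi2⟩ := bpar.V_bd hl ht
  obtain ⟨hu0, hu⟩ := bpar.u_bd hl ht
  obtain ⟨hρ0, hρ⟩ := bpar.ρs_bd hl ht
  have hQ := Qn2_le (t := t) hl hn
  have hT2 : |Z - 1| * (6 * Real.pi) * ((((LatW l n t).Q * ((LatW l n t).n * (LatW l n t).n) : ℕ) : ℝ) * (LatW l n t).P.Vhi +
      ((N : ℝ) + 1) * max (LatW l n t).P.u (LatW l n t).P.ρs) ≤ 40 * |Z - 1| * 𝒩 / (t : ℝ) ^ 4 := by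
    rw [P_eq, Params.scale_Vhi _ hc', Params.scale_u, Params.scale_ρs _ hc']
    have hN' : ((N : ℝ) + 1) = 𝒩 := by rw [h𝒩]; exact_mod_cast hN
    rw [hN']
    have hmax : max (bpar l t).u (bpar l t).ρs ≤ 1 / (t : ℝ) ^ 4 := by
      refine max_le (hu.trans (bpar.dle h1 zero_le_one le_rfl (by norm_num))) (hρ.trans ?_)
      -- `300/t²⁹ ≤ 1/t⁴`
      have := bpar.shrink hl ht (by norm_num : (0:ℝ) ≤ 300) (by norm_num : 27 + 1 ≤ 29)
      refine this.trans ?_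
      have := bpar.shrink hl ht (by norm_num : (0:ℝ) ≤ 300 / 96) (by norm_num : 4 + 1 ≤ 27)
      exact this.trans (bpar.dle h1 (by norm_num) (by norm_num) le_rfl)
    have hVm : (bpar l t).Vhi / (LatW l n t).m ≤ 1 / (t : ℝ) ^ 4 := by
      rw [div_le_div_iff₀ hm0 (by positivity), one_mul]
      have hl2 : (2:ℝ) ≤ l := by exact_mod_cast hl
      have hl4 : (1:ℝ) ≤ (l : ℝ) ^ 2 := by nlinarith
      have ht3 := bpar.T3 hl ht
      have ht4 : (0:ℝ) ≤ (t : ℝ) ^ 4 := by positivity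
      have ht7 : (0:ℝ) ≤ (t : ℝ) ^ 7 := by positivity
      calc (bpar l t).Vhi * (t : ℝ) ^ 4 ≤ (2 * (t : ℝ) ^ 3) * (t : ℝ) ^ 4 := mul_le_mul_of_nonneg_right (by linarith) ht4
        _ = 2 * (t : ℝ) ^ 7 * 1 := by ring
        _ ≤ 6 * (t : ℝ) ^ 7 * (l : ℝ) ^ 2 := by
            exact mul_le_mul (by linarith) hl4 zero_le_one (by positivity)
        _ ≤ _ := hm1
    have hQV : ((((LatW l n t).Q * ((LatW l n t).n * (LatW l n t).n) : ℕ) : ℝ)) * (bpar l t).Vhi ≤ 𝒩 / (t : ℝ) ^ 4 := by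
      have hV0 : 0 ≤ (bpar l t).Vhi := by have := pow_pos hT 3; linarith
      calc _ ≤ 𝒩 / (LatW l n t).m * (bpar l t).Vhi := mul_le_mul_of_nonneg_right hQ hV0
        _ = 𝒩 * ((bpar l t).Vhi / (LatW l n t).m) := by ring
        _ ≤ 𝒩 * (1 / (t : ℝ) ^ 4) := mul_le_mul_of_nonneg_left hVm h𝒩0.le
        _ = 𝒩 / (t : ℝ) ^ 4 := by ring
    have hmax' : 𝒩 * max (bpar l t).u (bpar l t).ρs ≤ 𝒩 / (t : ℝ) ^ 4 := by
      calc 𝒩 * max (bpar l t).u (bpar l t).ρs ≤ 𝒩 * (1 / (t : ℝ) ^ 4) := mul_le_mul_of_nonneg_left hmax h𝒩0.le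
        _ = 𝒩 / (t : ℝ) ^ 4 := by ring
    have hπ : 6 * Real.pi ≤ 20 := by have := Real.pi_lt_d2; linarith
    have hZ0 : 0 ≤ |Z - 1| := abs_nonneg _
    calc |Z - 1| * (6 * Real.pi) * (_ + _) ≤ |Z - 1| * (6 * Real.pi) * (𝒩 / (t : ℝ) ^ 4 + 𝒩 / (t : ℝ) ^ 4) :=
          mul_le_mul_of_nonneg_left (add_le_add hQV hmax') (by positivity)
      _ ≤ |Z - 1| * 20 * (𝒩 / (t : ℝ) ^ 4 + 𝒩 / (t : ℝ) ^ 4) := by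
          refine mul_le_mul_of_nonneg_right (mul_le_mul_of_nonneg_left hπ hZ0) (by positivity)
      _ = 40 * |Z - 1| * 𝒩 / (t : ℝ) ^ 4 := by ring
  unfold Lat.Fmin
  have e : β * 𝒩 * ((9 / 350) * (t : ℝ) ^ 2 / (l : ℝ) ^ 2 - 40 * |Z - 1| / (t : ℝ) ^ 4) =
      β * ((9 / 350) * 𝒩 * (t : ℝ) ^ 2 / (l : ℝ) ^ 2) - β * (40 * |Z - 1| * 𝒩 / (t : ℝ) ^ 4) := by ring
  rw [e]
  have := mul_le_mul_of_nonneg_left hT1 hβ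
  have := mul_le_mul_of_nonneg_left hT2 hβ
  linarith

end LatW

end FinalIneq

end EquilibriumClampedCollisionalWindowLDNegative

end Summit.AtomisticToContinuum.HydrodynamicLimit.Theorems

end
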